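import Literature.IUT.LogVolume.Corollary22Statement
import HarnessLib

/-!
# [IUTchIV] Corollary 2.2 (ii): points with integral `j`-invariant — in particular the CM points
# `j ∈ {0, 1728}` — have `log(q^∀) = 0`

Mochizuki, *Inter-universal Teichmüller theory IV*, RIMS manuscript (Apr. 2020; = PRIMS **57** (2021)),
Cor. 2.2 (ii), p. 42: the exceptional set `Exc_d` "contains all points corresponding to elliptic curves
that admit automorphisms of order `> 2`" (the four points with `j ∈ {0, 1728}`, excluded on p. 43 "in
order to apply Proposition 1.8"), and "the function `log(q^∀(−))` … is `≤ H_unif·ε_d^{−3}·d^{4+ε_d} + H_K`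
on `Exc_d`".  In the tree's model (`Corollary22Statement.lean`) `log(q^{∤S}(λ))` is the normalized degree
of the `q`-parameter divisor `Σ_{v bad, v ∤ S} h_v·[v]`, supported on `badPlaces P` = the finite places at
which `j(λ)` is NOT integral (Mathlib `HeightOneSpectrum.Support`, `{v | 1 < v(j(λ))}`).

PROVED here (classical, proof-only, no definitions): if `j(λ)` is integral at every finite place — e.g.
`j(λ) ∈ 𝓞_F`, `j(λ) = n ∈ ℤ`, and in particular `j(λ) ∈ {0, 1728}` (this includes the tree's junk value
`j = 0` at the cusps `λ ∈ {0, 1}`) — then `badPlaces P = ∅`, the `q`-parameter divisor away from ANY `S`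
vanishes, and `log(q^{∤S}(λ)) = 0`; hence `log(q^∀) = log(q^{∤2}) = 0` and the CM points lie in every
"low range" `{log(q^∀) ≤ B}` with `B ≥ 0` (the shape in which the birth skeleton of the route
`Summit.ABC.ABC.Theses.IUTThetaPilot` (crux `ThetaPartII`, stub `stub_cmLow`) places them inside `Exc_d`).
This is the classical fact "integral `j` ⟹ no place of potentially multiplicative reduction" read through
the tree's DEFINITION of the local height `max(0, −ord_v j)`; nothing here takes a side on [IUTchIII]
Cor. 3.12.
-/

noncomputable section

namespace Literature.IUT.LogVolume

namespace Cor22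

open NumberField IsDedekindDomain Literature.NumberTheory.DiophantineGeometry.GenEll

/-- If `j(λ)` has valuation `≤ 1` at every finite place of `F` (i.e. is integral everywhere), the set of
bad places (places of potentially multiplicative reduction, `ord_v j < 0`) is empty.
[claim: Mochizuki2012, status: disputed] -/
theorem badPlaces_eq_empty_of_valuation_le_one (P : NFPoint)
    (h : ∀ v : HeightOneSpectrum (𝓞 P.F), v.valuation P.F (jInv P.x) ≤ 1) : badPlaces P = ∅ := by
  unfold badPlaces
  rw [Set.Finite.toFinset_eq_empty, Set.eq_empty_iff_forall_notMem]
  intro v hv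
  exact absurd hv (not_lt.mpr (h v))

/-- If `j(λ)` lies in the ring of integers `𝓞_F`, there are no bad places.
[claim: Mochizuki2012, status: disputed] -/
theorem badPlaces_eq_empty_of_mem_ringOfIntegers (P : NFPoint) (y : 𝓞 P.F)
    (hy : jInv P.x = (y : P.F)) : badPlaces P = ∅ := by
  refine badPlaces_eq_empty_of_valuation_le_one P fun v => ?_
  rw [hy]
  exact HeightOneSpectrum.valuation_le_one v y

/-- If `j(λ) = n` is a rational integer, there are no bad places.
[claim: Mochizuki2012, status: disputed] -/
theorem badPlaces_eq_empty_of_eq_intCast (P : NFPoint) (n : ℤ) (hn : jInv P.x = (n : P.F)) :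
    badPlaces P = ∅ :=
  badPlaces_eq_empty_of_mem_ringOfIntegers P (n : 𝓞 P.F) (by rw [hn]; norm_cast)

/-- If `j(λ) = n` is a natural number, there are no bad places.
[claim: Mochizuki2012, status: disputed] -/
theorem badPlaces_eq_empty_of_eq_natCast (P : NFPoint) (n : ℕ) (hn : jInv P.x = (n : P.F)) :
    badPlaces P = ∅ :=
  badPlaces_eq_empty_of_mem_ringOfIntegers P (n : 𝓞 P.F) (by rw [hn]; norm_cast)

/-- With no bad places the `q`-parameter divisor away from any `S` is the zero divisor.
[claim: Mochizuki2012, status: disputed] -/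
theorem qDivisor_eq_zero_of_badPlaces_eq_empty (P : NFPoint) (S : Finset ℕ) (h : badPlaces P = ∅) :
    qDivisor P S = 0 := by
  classical
  unfold qDivisor
  rw [h, Finset.filter_empty, Finset.sum_empty]

/-- With no bad places, `log(q^{∤S}(λ)) = 0` for every `S`.
[claim: Mochizuki2012, status: disputed] -/
theorem logQAvoid_eq_zero_of_badPlaces_eq_empty (P : NFPoint) (S : Finset ℕ) (h : badPlaces P = ∅) :
    logQAvoid P S = 0 := by
  unfold logQAvoid
  rw [qDivisor_eq_zero_of_badPlaces_eq_empty P S h, map_zero]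

/-- Integral `j`-invariant ⟹ `log(q^{∤S}(λ)) = 0` for every `S` ("`h_v = 0` for those `v` at which `E_F`
has good reduction", [IUTchIV] p. 44, read through the tree's definition `h_v = max(0, −ord_v j)`).
[claim: Mochizuki2012, status: disputed] -/
theorem logQAvoid_eq_zero_of_mem_ringOfIntegers (P : NFPoint) (y : 𝓞 P.F)
    (hy : jInv P.x = (y : P.F)) (S : Finset ℕ) : logQAvoid P S = 0 :=
  logQAvoid_eq_zero_of_badPlaces_eq_empty P S (badPlaces_eq_empty_of_mem_ringOfIntegers P y hy)

/-- `j(λ) = n ∈ ℤ` ⟹ `log(q^{∤S}(λ)) = 0` for every `S`. [claim: Mochizuki2012, status: disputed] -/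
theorem logQAvoid_eq_zero_of_eq_intCast (P : NFPoint) (n : ℤ) (hn : jInv P.x = (n : P.F))
    (S : Finset ℕ) : logQAvoid P S = 0 :=
  logQAvoid_eq_zero_of_badPlaces_eq_empty P S (badPlaces_eq_empty_of_eq_intCast P n hn)

/-- `j(λ) = 0` ⟹ `log(q^{∤S}(λ)) = 0` for every `S` (this covers the CM point `j = 0` AND the tree's junk
value `jInv = 0` at the cusps `λ ∈ {0, 1}`). [claim: Mochizuki2012, status: disputed] -/
theorem logQAvoid_eq_zero_of_jInv_eq_zero (P : NFPoint) (h0 : jInv P.x = 0) (S : Finset ℕ) :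
    logQAvoid P S = 0 :=
  logQAvoid_eq_zero_of_badPlaces_eq_empty P S
    (badPlaces_eq_empty_of_eq_natCast P 0 (by rw [h0]; norm_cast))

/-- `j(λ) = 1728` ⟹ `log(q^{∤S}(λ)) = 0` for every `S`. [claim: Mochizuki2012, status: disputed] -/
theorem logQAvoid_eq_zero_of_jInv_eq_1728 (P : NFPoint) (h : jInv P.x = 1728) (S : Finset ℕ) :
    logQAvoid P S = 0 :=
  logQAvoid_eq_zero_of_badPlaces_eq_empty P S
    (badPlaces_eq_empty_of_eq_natCast P 1728 (by rw [h]; norm_cast))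

/-- **The CM points have `log(q^∀) = 0`** ([IUTchIV] Cor. 2.2 (ii), p. 42: the points "corresponding to
elliptic curves that admit automorphisms of order `> 2`", `j ∈ {0, 1728}`, have integral `j`, hence no
place of potentially multiplicative reduction, hence zero `q`-parameter divisor): in the tree's model,
`jInv P.x = 0 ∨ jInv P.x = 1728 → logQForall P = 0`.  This is the content of the stub `stub_cmLow` of the
birth skeleton of the crux `Summit.ABC.ABC.Theses.IUTThetaPilot.ThetaPartII` (the CM clause of
`Cor22.PartII` is then met by any exceptional set of the form `{log(q^∀) ≤ B}`, `B ≥ 0`).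
[claim: Mochizuki2012, status: disputed] -/
theorem logQForall_eq_zero_of_jInv_cm (P : NFPoint) (h : jInv P.x = 0 ∨ jInv P.x = 1728) :
    logQForall P = 0 := by
  rcases h with h0 | h1728
  · exact logQAvoid_eq_zero_of_jInv_eq_zero P h0 ∅
  · exact logQAvoid_eq_zero_of_jInv_eq_1728 P h1728 ∅

/-- The CM points have `log(q^{∤2}) = 0` as well. [claim: Mochizuki2012, status: disputed] -/
theorem logQNotTwo_eq_zero_of_jInv_cm (P : NFPoint) (h : jInv P.x = 0 ∨ jInv P.x = 1728) :
    logQNotTwo P = 0 := by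
  rcases h with h0 | h1728
  · exact logQAvoid_eq_zero_of_jInv_eq_zero P h0 {2}
  · exact logQAvoid_eq_zero_of_jInv_eq_1728 P h1728 {2}

/-- The CM points have `log(q^{∤S}) = 0` for every `S` (in particular the `log(q) = log(q^{∤{2,l}})` of
the constructed initial Θ-data, p. 46 (P5)). [claim: Mochizuki2012, status: disputed] -/
theorem logQAvoid_eq_zero_of_jInv_cm (P : NFPoint) (h : jInv P.x = 0 ∨ jInv P.x = 1728)
    (S : Finset ℕ) : logQAvoid P S = 0 := by
  rcases h with h0 | h1728
  · exact logQAvoid_eq_zero_of_jInv_eq_zero P h0 S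
  · exact logQAvoid_eq_zero_of_jInv_eq_1728 P h1728 S

/-- The CM points lie in every low range `{P | log(q^∀(P)) ≤ B}` with `B ≥ 0` — the form in which an
exceptional set `Exc_d := U^{≤d} ∩ {log(q^∀) ≤ B}` meets the membership clause
`jInv P.x = 0 ∨ jInv P.x = 1728 → P ∈ Exc` of `Cor22.PartII`. [claim: Mochizuki2012, status: disputed] -/
theorem logQForall_le_of_jInv_cm (P : NFPoint) (h : jInv P.x = 0 ∨ jInv P.x = 1728) {B : ℝ}
    (hB : 0 ≤ B) : logQForall P ≤ B := by
  rw [logQForall_eq_zero_of_jInv_cm P h]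
  exact hB

/-- The `PartII` membership clause for a low-range exceptional set: with
`Exc := {P ∈ T | logQForall P ≤ B}`, `B ≥ 0`, every point of `T` with `j ∈ {0, 1728}` lies in `Exc`.
[claim: Mochizuki2012, status: disputed] -/
theorem mem_lowRange_of_jInv_cm {T : Set NFPoint} {B : ℝ} (hB : 0 ≤ B) {P : NFPoint} (hP : P ∈ T)
    (h : jInv P.x = 0 ∨ jInv P.x = 1728) : P ∈ {Q ∈ T | logQForall Q ≤ B} :=
  ⟨hP, logQForall_le_of_jInv_cm P h hB⟩

end Cor22

end Literature.IUT.LogVolume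

end
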